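import Summits.AnomalousDissipation.AnomalousDissipation.Theorems.QuarticTightness.Negative.Anatomy
import Summits.AnomalousDissipation.AnomalousDissipation.Theorems.MomentParityMomentClosure
import Summits.AnomalousDissipation.AnomalousDissipation.Theorems.MomentParityGalerkinLiouvilleTest
import Summits.AnomalousDissipation.AnomalousDissipation.Theorems.GalerkinInvariantLoud.Negative.Absorbing
import Literature.Analysis.FluidPDE.GalerkinInvariantMeasure

/-!
# Route MomentParity · crux `QuarticTightness` (stmt-AnomalousDissipation-14331), line `horizon-shooting`:
# converse of the packaging, part I — selection, semiflow invariance of invariant witnesses, window Fubini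

Support file of the line lead (prover-line-stmt-AnomalousDissipation-14331-0). The landed glue
`MomentParityQuarticTightness.stub_horizonKrylovBogoliubov` turns HORIZON LOUDNESS at `(f, ν, N)` (for every
horizon one mean-zero Galerkin datum in the absorbing ball with window work `≥ ε'T` and window energy `≤ E'T`)
into an `IsInvariantWitness`. This file and its sequel
`MomentParityQuarticTightnessStubHorizonConverse.lean` prove the CONVERSE up to explicit constants, so that the
open stub of the line (`stub_universalHorizonLoud`) is certified to be EXACTLY crux-sized — equivalent, force by
force and viscosity by viscosity, to the existence of loud bounded Galerkin-invariant laws. Here (part I):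

* `exists_mem_of_integral_selection` — abstract two-budget selection: on a probability space, `0 ≤ X ≤ F√Y`,
  `∫X ≥ ε`, `∫Y ≤ E` give a point with `X ≥ ε/2` and `Y ≤ M` as soon as `F·E ≤ (ε/4)√M`.
* `map_galerkinCoeffFlow_map_eq_of_isInvariantWitness` — an invariant witness, pushed to the Galerkin phase
  space by `u ↦ û|_{≤N}`, is invariant under the Galerkin semiflow (polynomial rows ⇒ `C¹` cylindrical rows,
  `MomentParityMomentClosure.integral_nsGeneratorPairing_grad_eq_zero`; ⇒ Liouville equation of the Galerkin
  system, `MomentParity.integral_fderiv_galerkinRHS_comp_eq_zero`; ⇒ invariance,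
  `Literature.Analysis.FluidPDE.map_galerkinCoeffFlow_eq_self`).
* `stub_windowFubini` (registered stub of the line's skeleton, calibration section) — **Fubini along an
  invariant law of the Galerkin semiflow**: for a probability law on the phase space carried by a compact part of
  `galerkinSubspace S` and invariant under `galerkinCoeffFlow`, the window functional `c ↦ ∫₀ᵀ φ(φ_t c) dt` of a
  continuous `φ` is integrable with mean `T ∫ φ` (joint continuity of the semiflow, `continuousOn_galerkinCoeffFlow`).
The converse itself (`stub_horizonConverse`) is part II.

Sources: Krylov–Bogoliubov / invariant measures of the Galerkin approximations and the Liouville equation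
(FMRT 2001, Ch. IV App. B.1); Tobasco–Goluskin–Doering 2018 §5 (max over invariant measures = sup over
trajectories). No new definitions; no theorem here concludes a Theses decl.
-/

noncomputable section

-- `Summit.<Summit>.<Problem>` is the tree's mandated summit-side namespace (CONVENTIONS §2); for this
-- single-conjunct summit the two coincide, so the duplicate is deliberate.
set_option linter.dupNamespace false

namespace Summit.AnomalousDissipation.AnomalousDissipation.Theorems.MomentParityQuarticTightness

open MeasureTheory Filter Topology Set Function
open scoped ENNReal InnerProductSpace RealInnerProductSpace
open Literature.Analysis.FunctionSpaces Literature.Analysis.FunctionSpaces.Torus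
open Literature.Analysis.FluidPDE Literature.Analysis.FluidPDE.Torus
open Summit.AnomalousDissipation.AnomalousDissipation.Theses.MomentParity
open Summit.AnomalousDissipation.AnomalousDissipation.Theorems
open Summit.AnomalousDissipation.AnomalousDissipation.Theorems.QuarticGate.Negative
open Summit.AnomalousDissipation.AnomalousDissipation.Theorems.QuarticTightness.Negative

-- `T3 = T³`, `R3 = ℝ³`, `H3 = H`, `L2T3 = L²(T³; ℝ³)` (sibling crux's abbreviations).
open Summit.AnomalousDissipation.AnomalousDissipation.Theorems.CubicParityLoud.Negative (T3 R3 H3 L2T3)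

/-! ## A. Two-budget selection on a probability space -/

/-- **Two-budget selection.** On a probability space let `X ≤ F√Y` and `0 ≤ Y` a.e., `0 ≤ F`, `∫X ≥ ε > 0`,
`∫Y ≤ E`, and let `M > 0` satisfy `F·E ≤ (ε/4)√M`. Then some point of any full-measure set `S` has `X ≥ ε/2`
and `Y ≤ M`: on `{Y > M}`, `X ≤ F·Y/√M`, so that part of `∫X` is `≤ FE/√M ≤ ε/4`, and the rest `∫_{Y ≤ M} X ≥ 3ε/4`
cannot come from values `< ε/2`. [folklore] -/
theorem exists_mem_of_integral_selection {α : Type*} [MeasurableSpace α] {μ : Measure α}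
    [IsProbabilityMeasure μ] {X Y : α → ℝ} (hXi : Integrable X μ) (hYi : Integrable Y μ)
    (hY0 : ∀ᵐ a ∂μ, 0 ≤ Y a) {F ε E M : ℝ} (hF : 0 ≤ F) (hε : 0 < ε) (hM : 0 < M)
    (hXY : ∀ᵐ a ∂μ, X a ≤ F * Real.sqrt (Y a)) (hX : ε ≤ ∫ a, X a ∂μ) (hY : ∫ a, Y a ∂μ ≤ E)
    (hFE : F * E ≤ ε / 4 * Real.sqrt M) {S : Set α} (hS : ∀ᵐ a ∂μ, a ∈ S) :
    ∃ a ∈ S, ε / 2 ≤ X a ∧ Y a ≤ M := by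
  classical
  by_contra hcon
  push Not at hcon
  -- split `X = X·𝟙{Y ≤ M} + X·𝟙{Y > M}` and bound both parts a.e.
  have hsM : 0 < Real.sqrt M := Real.sqrt_pos.2 hM
  have hpt : ∀ᵐ a ∂μ, X a ≤ ε / 2 + F / Real.sqrt M * Y a := by
    filter_upwards [hS, hY0, hXY] with a ha hY0a hXYa
    by_cases hYa : Y a ≤ M
    · have h1 : X a < ε / 2 := by
        by_contra h1
        exact absurd (hcon a ha (not_lt.1 h1)) (not_lt.2 hYa)
      have h2 : 0 ≤ F / Real.sqrt M * Y a := mul_nonneg (div_nonneg hF hsM.le) hY0a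
      linarith
    · push Not at hYa
      have hsY : Real.sqrt M ≤ Real.sqrt (Y a) := Real.sqrt_le_sqrt hYa.le
      have h3 : Real.sqrt (Y a) ≤ Y a / Real.sqrt M := by
        rw [le_div_iff₀ hsM]
        calc Real.sqrt (Y a) * Real.sqrt M ≤ Real.sqrt (Y a) * Real.sqrt (Y a) :=
              mul_le_mul_of_nonneg_left hsY (Real.sqrt_nonneg _)
          _ = Y a := Real.mul_self_sqrt hY0a
      calc X a ≤ F * Real.sqrt (Y a) := hXYa
        _ ≤ F * (Y a / Real.sqrt M) := mul_le_mul_of_nonneg_left h3 hF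
        _ = F / Real.sqrt M * Y a := by ring
        _ ≤ ε / 2 + F / Real.sqrt M * Y a := by linarith
  have hint : ∫ a, X a ∂μ ≤ ∫ a, (ε / 2 + F / Real.sqrt M * Y a) ∂μ :=
    integral_mono_ae hXi ((integrable_const _).add (hYi.const_mul _)) hpt
  rw [integral_add (integrable_const _) (hYi.const_mul _), integral_const, integral_const_mul,
    smul_eq_mul, probReal_univ, one_mul] at hint
  -- `F/√M · ∫Y ≤ F E/√M ≤ ε/4`
  have h4 : F / Real.sqrt M * ∫ a, Y a ∂μ ≤ ε / 4 := by
    calc F / Real.sqrt M * ∫ a, Y a ∂μ ≤ F / Real.sqrt M * E :=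
          mul_le_mul_of_nonneg_left hY (div_nonneg hF hsM.le)
      _ = F * E / Real.sqrt M := by ring
      _ ≤ ε / 4 := by rw [div_le_iff₀ hsM]; exact hFE
  linarith

/-! ## B. Invariant witnesses are invariant under the Galerkin semiflow (phase-space form) -/

/-- The coefficient map `u ↦ û|_{≤N}` from `H` to the level-`N` coefficient space is continuous (each Fourier
coefficient is `1`-Lipschitz on `H`, `MomentParityMomentClosure.continuous_mFourierCoeff_coe`). [folklore] -/
theorem continuous_fourierRestrict_coe (N : ℕ) :
    Continuous fun u : H3 => fourierRestrict (freqBall N) (u.1 : T3 → R3) := by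
  refine continuous_pi fun k => ?_
  simp only [fourierRestrict_apply]
  exact MomentParityMomentClosure.continuous_mFourierCoeff_coe (k : Fin 3 → ℤ)

/-- **An invariant witness, pushed to the Galerkin phase space, is invariant under the Galerkin semiflow.**
For `ν > 0`, a smooth mean-zero force `f` and an `IsInvariantWitness f ν N R E' ε' μ`, the law
`μ' = (u ↦ û|_{≤N})_* μ` of the coefficients satisfies `(φ_t)_* μ' = μ'` for every `t ≥ 0`, where `φ_t` is the
coefficient semiflow `galerkinCoeffFlow ν (f̂|_{≤N}) t`. Chain: all polynomial rows vanish (witness) ⇒ all `C¹`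
compactly supported cylindrical rows vanish (`integral_nsGeneratorPairing_grad_eq_zero`, Weierstrass on the
compact level ball) ⇒ stationary Liouville equation of the Galerkin system for `μ'`
(`integral_fderiv_galerkinRHS_comp_eq_zero`) ⇒ invariance (`map_galerkinCoeffFlow_eq_self`). [folklore] -/
theorem map_galerkinCoeffFlow_map_eq_of_isInvariantWitness {f : T3 → R3} (hfs : Torus.IsSmooth f)
    (hfz : Torus.HasZeroMean f) {ν : ℝ} (hν : 0 < ν) {N : ℕ} {R E' ε' : ℝ} {μ : Measure H3}
    (hw : IsInvariantWitness f ν N R E' ε' μ) (t : ℝ) (ht : 0 ≤ t) :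
    (μ.map fun u : H3 => fourierRestrict (freqBall N) (u.1 : T3 → R3)).map
        (galerkinCoeffFlow ν (fourierRestrict (freqBall N) f) t) =
      μ.map fun u : H3 => fourierRestrict (freqBall N) (u.1 : T3 → R3) := by
  obtain ⟨hp, hlev, hball, hinv, -, -⟩ := hw
  haveI := hp
  have hf2 : MemLp f 2 volume := hfs.memLp 2
  have hfi : Integrable f volume := hf2.integrable one_le_two
  have hS : ∀ k ∈ freqBall (d := Fin 3) N, -k ∈ freqBall (d := Fin 3) N := neg_mem_freqBall_of_mem
  have hg : IsRealCoeff (fourierRestrict (freqBall N) f) := isRealCoeff_mFourierCoeff hfi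
  -- nonnegativity of the radius and the compact carrier in `H`
  have hR : 0 ≤ R := by
    obtain ⟨u, hu⟩ := hball.exists
    exact (norm_nonneg u).trans hu
  set K : Set H3 := {u : H3 | IsLevel N u ∧ ‖u‖ ≤ R} with hKdef
  have hK : IsCompact K := MomentParityMomentClosure.isCompact_levelBall N hR
  have hμK : ∀ᵐ u ∂μ, u ∈ K := hlev.and hball
  -- the coefficient map and the pushed-forward law
  set Tc : H3 → (↥(freqBall (d := Fin 3) N) → EuclideanSpace ℂ (Fin 3)) :=
    fun u => fourierRestrict (freqBall N) (u.1 : T3 → R3) with hTc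
  have hTc_cont : Continuous Tc := continuous_fourierRestrict_coe N
  have hTc_meas : Measurable Tc := hTc_cont.measurable
  set μ' := μ.map Tc with hμ'
  haveI : IsProbabilityMeasure μ' := Measure.isProbabilityMeasure_map hTc_meas.aemeasurable
  -- its compact carrier inside the phase space
  have hK' : IsCompact (Tc '' K) := hK.image hTc_cont
  have hK'V : Tc '' K ⊆ ((galerkinSubspace (freqBall (d := Fin 3) N) :
      Submodule ℝ (↥(freqBall (d := Fin 3) N) → EuclideanSpace ℂ (Fin 3))) :
        Set (↥(freqBall (d := Fin 3) N) → EuclideanSpace ℂ (Fin 3))) := by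
    rintro _ ⟨u, -, rfl⟩
    exact MomentParity.fourierRestrict_coe_mem_galerkinSubspace N u
  have hμ'K : μ' (Tc '' K)ᶜ = 0 := by
    rw [hμ', Measure.map_apply hTc_meas (hK'.isClosed.measurableSet.compl)]
    refine measure_mono_null (fun u hu hK => hu ⟨u, hK, rfl⟩) ?_
    exact mem_ae_iff.1 hμK
  -- `C¹` cylindrical rows with band-limited fields vanish
  have h4 : ∀ Φ : CylindricalTest (Fin 3),
      (∀ i, ∀ k ∉ (freqBall N).erase (0 : Fin 3 → ℤ),
        UnitAddTorus.mFourierCoeff (EuclideanSpace.complexify ∘ Φ.g i) k = 0) →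
      Integrable (fun u => nsGeneratorPairing ν f u (Φ.grad u)) μ ∧
        ∫ u, nsGeneratorPairing ν f u (Φ.grad u) ∂μ = 0 := by
    intro Φ hΦ
    have hband : ∀ i, IsBandTest N (Φ.g i) := fun i =>
      ⟨Φ.g_smooth i, Φ.g_divFree i, Φ.g_zeroMean i, hΦ i⟩
    refine ⟨MomentParityMomentClosure.integrable_of_continuous_of_ae_mem hK hμK
      (continuous_nsGeneratorPairing_grad ν hfi Φ), ?_⟩
    exact MomentParityMomentClosure.integral_nsGeneratorPairing_grad_eq_zero ν hfi hR hμK Φ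
      fun P => (hinv Φ.m Φ.g P hband).2
  -- the Liouville equation of the Galerkin system for `μ'`
  have hL : ∀ ψ : (↥(freqBall (d := Fin 3) N) → EuclideanSpace ℂ (Fin 3)) → ℝ, ContDiff ℝ 1 ψ →
      HasCompactSupport ψ →
      ∫ c, fderiv ℝ ψ c (galerkinRHS (freqBall N) ν (fourierRestrict (freqBall N) f) c) ∂μ' = 0 := by
    intro ψ hψ _
    have key := (MomentParity.integral_fderiv_galerkinRHS_comp_eq_zero ν hf2 hfz hlev hball h4 hψ).2
    rw [hμ', integral_map hTc_meas.aemeasurable]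
    · exact key
    · refine Continuous.aestronglyMeasurable ?_
      exact ((hψ.continuous_fderiv one_ne_zero).clm_apply
        (contDiff_galerkinRHS ν (fourierRestrict (freqBall N) f) (n := 1)).continuous)
  exact map_galerkinCoeffFlow_eq_self hν.le hS hg hK' hK'V hμ'K hL t ht


/-! ## C. Window functionals of an invariant law of the Galerkin semiflow: Fubini -/

/-- **Fubini along an invariant law of the Galerkin semiflow.** On a finite symmetric frequency set `S` with
real force coefficients `g` and `ν ≥ 0`, let `μ'` be a Borel probability law on the coefficient space carried
by a compact `K ⊆ galerkinSubspace S` and invariant under the coefficient semiflow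
(`(φ_t)_* μ' = μ'`, `t ≥ 0`). Then for every continuous `φ` and horizon `T > 0` the window functional
`c ↦ ∫₀ᵀ φ(φ_t c) dt` is `μ'`-integrable and `∫ (∫₀ᵀ φ(φ_t c) dt) dμ'(c) = T ∫ φ dμ'`
(joint continuity of the semiflow on `[0,∞) × galerkinSubspace S`, `continuousOn_galerkinCoeffFlow`). [folklore] -/
theorem stub_windowFubini {S : Finset (Fin 3 → ℤ)} {ν : ℝ} (hν : 0 ≤ ν)
    (hS : ∀ k ∈ S, -k ∈ S) {g : ↥S → EuclideanSpace ℂ (Fin 3)} (hg : IsRealCoeff g)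
    {μ' : Measure (↥S → EuclideanSpace ℂ (Fin 3))} [IsProbabilityMeasure μ']
    {K : Set (↥S → EuclideanSpace ℂ (Fin 3))} (hK : IsCompact K)
    (hKV : K ⊆ (galerkinSubspace S : Set (↥S → EuclideanSpace ℂ (Fin 3))))
    (hμK : μ' Kᶜ = 0) (hinv : ∀ t, 0 ≤ t → μ'.map (galerkinCoeffFlow ν g t) = μ')
    {φ : (↥S → EuclideanSpace ℂ (Fin 3)) → ℝ} (hφ : Continuous φ) {T : ℝ} (hT : 0 < T) :
    Integrable (fun c => ∫ t in (0 : ℝ)..T, φ (galerkinCoeffFlow ν g t c)) μ' ∧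
      ∫ c, (∫ t in (0 : ℝ)..T, φ (galerkinCoeffFlow ν g t c)) ∂μ' = T * ∫ c, φ c ∂μ' := by
  set V : Set (↥S → EuclideanSpace ℂ (Fin 3)) :=
    (galerkinSubspace S : Set (↥S → EuclideanSpace ℂ (Fin 3))) with hVdef
  have hVc : IsClosed V := (galerkinSubspace S).closed_of_finiteDimensional
  set lam : Measure ℝ := volume.restrict (Ioc 0 T) with hlam
  have hlam_univ : lam univ = ENNReal.ofReal T := by
    rw [hlam, Measure.restrict_apply_univ, Real.volume_Ioc, sub_zero]
  haveI : IsFiniteMeasure lam := ⟨by rw [hlam_univ]; exact ENNReal.ofReal_lt_top⟩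
  -- a.e. localisation of the two factors
  have hμ'K : ∀ᵐ c ∂μ', c ∈ K :=
    (measure_eq_zero_iff_ae_notMem.1 hμK).mono fun c hc => by simpa using hc
  have hμ'V : ∀ᵐ c ∂μ', c ∈ V := hμ'K.mono fun c hc => hKV hc
  have hlamI : ∀ᵐ t ∂lam, t ∈ Ioc (0 : ℝ) T := ae_restrict_mem measurableSet_Ioc
  -- the integrand on the product space and its continuity on `V × [0, ∞)`
  set G : (↥S → EuclideanSpace ℂ (Fin 3)) × ℝ → ℝ :=
    fun p => φ (galerkinCoeffFlow ν g p.2 p.1) with hGdef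
  have hGc : ContinuousOn G (V ×ˢ Ici (0 : ℝ)) := by
    have h1 := continuousOn_galerkinCoeffFlow hν hS hg
    have h2 : ContinuousOn (fun p : (↥S → EuclideanSpace ℂ (Fin 3)) × ℝ => (p.2, p.1)) (V ×ˢ Ici (0 : ℝ)) :=
      continuous_swap.continuousOn
    exact hφ.comp_continuousOn (h1.comp h2 fun p hp => ⟨hp.2, hp.1⟩)
  -- full measure of `K × (0, T]` for the product law
  have hfull : ∀ᵐ p ∂(μ'.prod lam), p ∈ K ×ˢ Ioc (0 : ℝ) T := by
    have h1 : (μ'.prod lam) (Kᶜ ×ˢ (univ : Set ℝ)) = 0 := by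
      rw [Measure.prod_prod, hμK, zero_mul]
    have h2 : (μ'.prod lam) ((univ : Set (↥S → EuclideanSpace ℂ (Fin 3))) ×ˢ (Ioc (0 : ℝ) T)ᶜ) = 0 := by
      rw [Measure.prod_prod]
      have : lam (Ioc (0 : ℝ) T)ᶜ = 0 := by
        rw [hlam, Measure.restrict_apply (measurableSet_Ioc.compl), Set.compl_inter_self, measure_empty]
      rw [this, mul_zero]
    rw [ae_iff]
    refine measure_mono_null ?_ (measure_union_null h1 h2)
    intro p hp
    simp only [Set.mem_setOf_eq, Set.mem_prod, not_and_or] at hp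
    rcases hp with hp | hp
    · exact Or.inl ⟨hp, Set.mem_univ _⟩
    · exact Or.inr ⟨Set.mem_univ _, hp⟩
  have hfullV : ∀ᵐ p ∂(μ'.prod lam), p ∈ V ×ˢ Ici (0 : ℝ) :=
    hfull.mono fun p hp => ⟨hKV hp.1, hp.2.1.le⟩
  -- measurability and boundedness ⇒ integrability on the product
  have hGm : AEStronglyMeasurable G (μ'.prod lam) := by
    have h := hGc.aestronglyMeasurable (hVc.measurableSet.prod measurableSet_Ici)
      (μ := μ'.prod lam)
    rwa [Measure.restrict_eq_self_of_ae_mem hfullV] at h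
  obtain ⟨C, hC⟩ := (hK.prod (isCompact_Icc (a := (0 : ℝ)) (b := T))).exists_bound_of_continuousOn
    (hGc.mono (Set.prod_mono hKV Icc_subset_Ici_self))
  have hGi : Integrable G (μ'.prod lam) :=
    Integrable.of_bound hGm C (hfull.mono fun p hp => hC p ⟨hp.1, Ioc_subset_Icc_self hp.2⟩)
  -- the slice integrals are the window integrals
  have hslice : ∀ c, ∫ t, G (c, t) ∂lam = ∫ t in (0 : ℝ)..T, φ (galerkinCoeffFlow ν g t c) := by
    intro c
    rw [intervalIntegral.integral_of_le hT.le]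
  -- (i) integrability of the window functional
  have hI : Integrable (fun c => ∫ t in (0 : ℝ)..T, φ (galerkinCoeffFlow ν g t c)) μ' := by
    have h := hGi.integral_prod_left
    simpa only [hslice] using h
  refine ⟨hI, ?_⟩
  -- (ii) Fubini and invariance
  have hswap : ∫ c, (∫ t, G (c, t) ∂lam) ∂μ' = ∫ t, (∫ c, G (c, t) ∂μ') ∂lam :=
    integral_integral_swap (by simpa only [Function.uncurry_def] using hGi)
  have hinner : ∀ t ∈ Ioc (0 : ℝ) T, ∫ c, G (c, t) ∂μ' = ∫ c, φ c ∂μ' := by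
    intro t ht
    have hmeas : AEMeasurable (galerkinCoeffFlow ν g t) μ' := by
      have hcont : ContinuousOn (fun c => galerkinCoeffFlow ν g t c) V :=
        (continuousOn_galerkinCoeffFlow hν hS hg).comp (continuousOn_const.prodMk continuousOn_id)
          fun c hc => ⟨mem_Ici.2 ht.1.le, hc⟩
      rw [← Measure.restrict_eq_self_of_ae_mem hμ'V]
      exact hcont.aemeasurable hVc.measurableSet
    have h := integral_map hmeas hφ.aestronglyMeasurable (μ := μ')
    rw [hinv t ht.1.le] at h
    exact h.symm
  calc ∫ c, (∫ t in (0 : ℝ)..T, φ (galerkinCoeffFlow ν g t c)) ∂μ'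
      = ∫ c, (∫ t, G (c, t) ∂lam) ∂μ' := by simp only [hslice]
    _ = ∫ t, (∫ c, G (c, t) ∂μ') ∂lam := hswap
    _ = ∫ t, (∫ c, φ c ∂μ') ∂lam := integral_congr_ae (hlamI.mono fun t ht => hinner t ht)
    _ = T * ∫ c, φ c ∂μ' := by
        rw [integral_const, smul_eq_mul, measureReal_def, hlam_univ, ENNReal.toReal_ofReal hT.le]


end Summit.AnomalousDissipation.AnomalousDissipation.Theorems.MomentParityQuarticTightness

end
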